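import Literature.Topology.FourManifolds.SurfaceGroupHomology
import Literature.Topology.FourManifolds.GroupTrisections
import Mathlib.GroupTheory.Abelianization.Defs
import Mathlib.GroupTheory.Nilpotent
import Mathlib.Algebra.Group.TypeTags.Hom
import Mathlib.LinearAlgebra.Basis.Defs
import Mathlib.LinearAlgebra.StdBasis
import Mathlib.LinearAlgebra.Span.Basic
import HarnessLib

/-!
# Kernels through the abelianisation of the surface group

Topic `Literature/Topology/FourManifolds`; theorems only, over `SurfaceGroupHomology.lean`
(`SurfaceGroup.abelianize : S_g →* Multiplicative (surfaceGen g → ℤ)`, the Hurewicz map of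
`S_g = ⟨a₁,b₁,…,a_g,b_g ∣ ∏[aᵢ,bᵢ]⟩` onto `H₁(Σ_g; ℤ) = ℤ^{2g}`) and `GroupTrisections.lean`
(`IsFreeOfRank`).  The exactness statements that turn subgroups of `S_g` with free quotients into
sublattices of `ℤ^{2g}`:

* `FreeGroup.mem_commutator_of_lift_eq_one` — a word of `F(ι)` (`ι` finite) with all exponent
  sums zero lies in `[F, F]` (`F^{ab} = ℤ^ι`; Magnus–Karrass–Solitar §2.3 / Lyndon–Schupp I.4);
* `SurfaceGroup.ker_abelianize` (`= [S_g, S_g]`, Hatcher §1.2 p. 51: the abelianisation of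
  `π₁(M_g)` is `ℤ^{2g}`), `SurfaceGroup.ker_abelianize_eq_lowerCentralSeries`
  (`= (⊤).lowerCentralSeries 1`), `SurfaceGroup.abelianize_surjective`;
* `SurfaceGroup.exists_linearMap_section_of_isFreeOfRank` — for `N ⊴ S_g` with `S_g ⧸ N ≅ F_n`
  and projection `φ : S_g ↠ F_n`: the exponent sums of `φ` factor through `abelianize` as a
  linear `R : ℤ^{2g} → ℤⁿ` with a linear section `U`, and `ker R` is the span of the image of
  `N` (exactness of `N → H₁(S_g) → H₁(F_n) → 0`);
* `SurfaceGroup.span_image_sup`, `span_image_top`, `span_image_normalClosure` — the image in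
  `H₁` of a join / of everything / of a normal closure.

## References

* A. Hatcher, *Algebraic Topology*, CUP (2002), §1.2 p. 51, §2.A. [HatcherAT2002]
-/

noncomputable section

namespace Literature.Topology.FourManifolds

open Multiplicative Subgroup

/-- **Exponent sums detect the commutator subgroup of a free group**: a word of the free group
on a finite alphabet all of whose exponent sums vanish lies in the commutator subgroup (the
abelianisation of `F(ι)` is the free abelian group `ℤ^ι`; Lyndon–Schupp I.Prop 4.4 area /
Magnus–Karrass–Solitar §2.3). [folklore] -/
theorem FreeGroup.mem_commutator_of_lift_eq_one {ι : Type*} [Fintype ι] [DecidableEq ι]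
    (x : FreeGroup ι)
    (hx : FreeGroup.lift (fun k : ι => ofAdd (Pi.single k (1 : ℤ))) x = 1) :
    x ∈ commutator (FreeGroup ι) := by
  set E : FreeGroup ι →* Multiplicative (ι → ℤ) :=
    FreeGroup.lift (fun k : ι => ofAdd (Pi.single k (1 : ℤ))) with hE
  -- the abelianisation and the two comparison maps
  set ψ : Abelianization (FreeGroup ι) →* Multiplicative (ι → ℤ) := Abelianization.lift E with hψ
  let χ : (ι → ℤ) →ₗ[ℤ] Additive (Abelianization (FreeGroup ι)) :=
    (Pi.basisFun ℤ ι).constr ℤ fun k => Additive.ofMul (Abelianization.of (FreeGroup.of k))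
  set φ : Multiplicative (ι → ℤ) →* Abelianization (FreeGroup ι) :=
    AddMonoidHom.toMultiplicativeLeft χ.toAddMonoidHom with hφ
  have hφψ : φ.comp ψ = MonoidHom.id _ := by
    refine Abelianization.hom_ext _ _ (FreeGroup.ext_hom _ _ fun k => ?_)
    rw [MonoidHom.comp_apply, MonoidHom.comp_apply, MonoidHom.id_comp, hψ,
      Abelianization.lift_apply_of, hE, FreeGroup.lift_apply_of, hφ,
      AddMonoidHom.toMultiplicativeLeft_apply_apply, toAdd_ofAdd]
    change Additive.toMul (χ (Pi.single k 1)) = _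
    rw [show (Pi.single k (1 : ℤ) : ι → ℤ) = Pi.basisFun ℤ ι k from (Pi.basisFun_apply _ _ k).symm,
      Module.Basis.constr_basis]
    rfl
  have hinj : Function.Injective ψ := by
    intro a b hab
    have := congrArg φ hab
    rwa [← MonoidHom.comp_apply, ← MonoidHom.comp_apply, hφψ] at this
  rw [← Abelianization.ker_of, MonoidHom.mem_ker]
  apply hinj
  rw [hψ, Abelianization.lift_apply_of, map_one]
  exact hx

/-- **The kernel of the abelianisation map of the surface group is its commutator subgroup**
(`H₁(Σ_g) = π₁^{ab} = ℤ^{2g}`, Hatcher §1.2 p. 51 / 2A): `ker (abelianize g) = [S_g, S_g]`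
(`= (⊤).lowerCentralSeries 1`). [cite: HatcherAT2002, §1.2 p. 51] -/
theorem SurfaceGroup.ker_abelianize (g : ℕ) :
    (SurfaceGroup.abelianize g).ker = commutator (SurfaceGroup g) := by
  apply le_antisymm
  · set ψ : Abelianization (SurfaceGroup g) →* Multiplicative (surfaceGen g → ℤ) :=
      Abelianization.lift (SurfaceGroup.abelianize g) with hψ
    let χ : (surfaceGen g → ℤ) →ₗ[ℤ] Additive (Abelianization (SurfaceGroup g)) :=
      (Pi.basisFun ℤ (surfaceGen g)).constr ℤ fun x =>
        Additive.ofMul (Abelianization.of (PresentedGroup.of x))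
    set φ : Multiplicative (surfaceGen g → ℤ) →* Abelianization (SurfaceGroup g) :=
      AddMonoidHom.toMultiplicativeLeft χ.toAddMonoidHom with hφ
    have hφψ : φ.comp ψ = MonoidHom.id _ := by
      refine Abelianization.hom_ext _ _ (PresentedGroup.ext fun x => ?_)
      rw [MonoidHom.comp_apply, MonoidHom.comp_apply, MonoidHom.id_comp, hψ,
        Abelianization.lift_apply_of, SurfaceGroup.abelianize_of, hφ,
        AddMonoidHom.toMultiplicativeLeft_apply_apply, toAdd_ofAdd]
      change Additive.toMul (χ (Pi.single x 1)) = _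
      rw [show (Pi.single x (1 : ℤ) : surfaceGen g → ℤ) = Pi.basisFun ℤ (surfaceGen g) x from
        (Pi.basisFun_apply _ _ x).symm, Module.Basis.constr_basis]
      rfl
    have hinj : Function.Injective ψ := by
      intro a b hab
      have := congrArg φ hab
      rwa [← MonoidHom.comp_apply, ← MonoidHom.comp_apply, hφψ] at this
    intro s hs
    rw [MonoidHom.mem_ker] at hs
    rw [← Abelianization.ker_of, MonoidHom.mem_ker]
    apply hinj
    rw [hψ, Abelianization.lift_apply_of, map_one]
    exact hs
  · exact Abelianization.commutator_subset_ker _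

/-- `ker (abelianize g)` is the first term `(⊤).lowerCentralSeries 1` of the lower central series.
[folklore] -/
theorem SurfaceGroup.ker_abelianize_eq_lowerCentralSeries (g : ℕ) :
    (SurfaceGroup.abelianize g).ker = (⊤ : Subgroup (SurfaceGroup g)).lowerCentralSeries 1 := by
  rw [Subgroup.top_lowerCentralSeries_one]
  exact SurfaceGroup.ker_abelianize g

/-- The abelianisation map is onto `ℤ^{2g}`. [folklore] -/
theorem SurfaceGroup.abelianize_surjective (g : ℕ) :
    Function.Surjective (SurfaceGroup.abelianize g) := by
  rw [← MonoidHom.range_eq_top, eq_top_iff]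
  rintro v -
  -- `v = ∏ δ_x ^ v x`
  have hv : v = ∏ x : surfaceGen g, (ofAdd (Pi.single x (1 : ℤ))) ^ (toAdd v x) := by
    rw [← ofAdd_toAdd v]
    conv_lhs => rw [← Finset.univ_sum_single (toAdd v)]
    rw [ofAdd_sum]
    refine Finset.prod_congr rfl fun x _ => ?_
    rw [← ofAdd_zsmul]
    congr 1
    ext y
    simp [Pi.single_apply]
  rw [hv]
  refine prod_mem fun x _ => Subgroup.zpow_mem _ ?_ _
  exact ⟨PresentedGroup.of x, SurfaceGroup.abelianize_of x⟩


/-- **Exponent sums of a free quotient, read on `H₁`.**  Let `N ⊴ S_g` be normal with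
`S_g ⧸ N ≅ F_n` free of rank `n`, and let `φ : S_g ↠ F_n` be the projection (kernel `N`).  The
character `s ↦ (exponent sums of φ s) ∈ ℤⁿ` factors through `abelianize` as a `ℤ`-linear map
`R : ℤ^{2g} → ℤⁿ`; it has a linear section `U` (`R ∘ U = id`, from lifts of the free generators),
and `ker R` is exactly the image of `N` in `H₁ = ℤ^{2g}` (exactness of
`N → H₁(S_g) → H₁(F_n) → 0`, using that exponent sums detect `[F_n, F_n]`).
[cite: HatcherAT2002, §1.2 p. 51] -/
theorem SurfaceGroup.exists_linearMap_section_of_isFreeOfRank {g n : ℕ}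
    (N : Subgroup (SurfaceGroup g)) [N.Normal] (hN : IsFreeOfRank (SurfaceGroup g ⧸ N) n) :
    ∃ (R : (surfaceGen g → ℤ) →ₗ[ℤ] (Fin n → ℤ)) (U : (Fin n → ℤ) →ₗ[ℤ] (surfaceGen g → ℤ))
      (φ : SurfaceGroup g →* FreeGroup (Fin n)),
      (∀ y, R (U y) = y) ∧
      (∀ s, R (toAdd (SurfaceGroup.abelianize g s)) =
        toAdd (FreeGroup.lift (fun k : Fin n => ofAdd (Pi.single k (1 : ℤ))) (φ s))) ∧
      Function.Surjective φ ∧ φ.ker = N ∧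
      LinearMap.ker R =
        Submodule.span ℤ ((fun s => toAdd (SurfaceGroup.abelianize g s)) '' (N : Set (SurfaceGroup g))) := by
  obtain ⟨e⟩ := hN
  set φ : SurfaceGroup g →* FreeGroup (Fin n) := e.symm.toMonoidHom.comp (QuotientGroup.mk' N) with hφ
  have hφs : Function.Surjective φ := e.symm.surjective.comp (QuotientGroup.mk'_surjective N)
  have hφk : φ.ker = N := by
    ext s
    rw [MonoidHom.mem_ker, hφ, MonoidHom.comp_apply, MulEquiv.coe_toMonoidHom,
      MulEquiv.map_eq_one_iff, QuotientGroup.mk'_apply, QuotientGroup.eq_one_iff]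
  set E : FreeGroup (Fin n) →* Multiplicative (Fin n → ℤ) :=
    FreeGroup.lift (fun k : Fin n => ofAdd (Pi.single k (1 : ℤ))) with hE
  set ρ : SurfaceGroup g →* Multiplicative (Fin n → ℤ) := E.comp φ with hρ
  -- `R`: the linear map through which `ρ` factors
  set R : (surfaceGen g → ℤ) →ₗ[ℤ] (Fin n → ℤ) :=
    (Pi.basisFun ℤ (surfaceGen g)).constr ℤ fun x => toAdd (ρ (PresentedGroup.of x)) with hR
  have hRsingle : ∀ x, R (Pi.single x 1) = toAdd (ρ (PresentedGroup.of x)) := fun x => by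
    rw [show (Pi.single x (1 : ℤ) : surfaceGen g → ℤ) = Pi.basisFun ℤ (surfaceGen g) x from
      (Pi.basisFun_apply _ _ x).symm, hR, Module.Basis.constr_basis]
  have hRθ : ∀ s, R (toAdd (SurfaceGroup.abelianize g s)) = toAdd (ρ s) := by
    have key : (AddMonoidHom.toMultiplicative R.toAddMonoidHom).comp (SurfaceGroup.abelianize g) = ρ := by
      refine PresentedGroup.ext fun x => ?_
      rw [MonoidHom.comp_apply, SurfaceGroup.abelianize_of, AddMonoidHom.toMultiplicative_apply_apply,
        toAdd_ofAdd, LinearMap.toAddMonoidHom_coe, hRsingle, ofAdd_toAdd]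
    intro s
    have := DFunLike.congr_fun key s
    rw [MonoidHom.comp_apply, AddMonoidHom.toMultiplicative_apply_apply,
      LinearMap.toAddMonoidHom_coe] at this
    rw [← this, toAdd_ofAdd]
  -- `U`: lifts of the free generators
  have hlift : ∀ k : Fin n, ∃ s : SurfaceGroup g, QuotientGroup.mk' N s = e (FreeGroup.of k) :=
    fun k => QuotientGroup.mk'_surjective N _
  choose sec hsec using hlift
  set U : (Fin n → ℤ) →ₗ[ℤ] (surfaceGen g → ℤ) :=
    (Pi.basisFun ℤ (Fin n)).constr ℤ fun k => toAdd (SurfaceGroup.abelianize g (sec k)) with hU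
  have hRU : R ∘ₗ U = LinearMap.id := by
    refine (Pi.basisFun ℤ (Fin n)).ext fun k => ?_
    rw [LinearMap.comp_apply, LinearMap.id_apply, hU, Module.Basis.constr_basis, hRθ, hρ,
      MonoidHom.comp_apply, hφ, MonoidHom.comp_apply, hsec, MulEquiv.coe_toMonoidHom,
      MulEquiv.symm_apply_apply, hE, FreeGroup.lift_apply_of, toAdd_ofAdd, Pi.basisFun_apply]
  refine ⟨R, U, φ, fun y => ?_, fun s => ?_, hφs, hφk, ?_⟩
  · exact DFunLike.congr_fun hRU y
  · rw [hRθ, hρ, MonoidHom.comp_apply]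
  -- the kernel
  apply le_antisymm
  · intro v hv
    rw [LinearMap.mem_ker] at hv
    obtain ⟨s, hs⟩ := SurfaceGroup.abelianize_surjective g (ofAdd v)
    have hs' : toAdd (SurfaceGroup.abelianize g s) = v := by rw [hs, toAdd_ofAdd]
    -- `φ s` has vanishing exponent sums, hence is a product of commutators
    have h1 : E (φ s) = 1 := by
      rw [← hs', hRθ, hρ, MonoidHom.comp_apply] at hv
      rw [← ofAdd_toAdd (E (φ s)), hv]
      rfl
    have h2 : φ s ∈ commutator (FreeGroup (Fin n)) :=
      FreeGroup.mem_commutator_of_lift_eq_one _ h1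
    have h3 : commutator (FreeGroup (Fin n)) = (commutator (SurfaceGroup g)).map φ := by
      rw [_root_.commutator_def, _root_.commutator_def, Subgroup.map_commutator, ← MonoidHom.range_eq_map,
        MonoidHom.range_eq_top.2 hφs]
    rw [h3, Subgroup.mem_map] at h2
    obtain ⟨c, hc, hcs⟩ := h2
    -- `s = c · q` with `q ∈ N`
    have hq : c⁻¹ * s ∈ N := by
      rw [← hφk, MonoidHom.mem_ker, map_mul, map_inv, hcs, inv_mul_cancel]
    have hθc : SurfaceGroup.abelianize g c = 1 := by
      have : c ∈ (SurfaceGroup.abelianize g).ker := by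
        rw [SurfaceGroup.ker_abelianize]; exact hc
      exact (MonoidHom.mem_ker).1 this
    refine Submodule.subset_span ⟨c⁻¹ * s, hq, ?_⟩
    simp only
    rw [map_mul, map_inv, hθc, inv_one, one_mul, hs']
  · rw [Submodule.span_le]
    rintro _ ⟨s, hs, rfl⟩
    rw [SetLike.mem_coe, LinearMap.mem_ker, hRθ, hρ, MonoidHom.comp_apply]
    have : φ s = 1 := by rw [← MonoidHom.mem_ker, hφk]; exact hs
    rw [this, map_one]
    rfl

/-- The image in `H₁` of a join of subgroups spans the join of the spans. [folklore] -/
theorem SurfaceGroup.span_image_sup {g : ℕ} (A B : Subgroup (SurfaceGroup g)) :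
    Submodule.span ℤ ((fun s => toAdd (SurfaceGroup.abelianize g s)) '' ((A ⊔ B : Subgroup _) : Set _)) =
      Submodule.span ℤ ((fun s => toAdd (SurfaceGroup.abelianize g s)) '' (A : Set _)) ⊔
        Submodule.span ℤ ((fun s => toAdd (SurfaceGroup.abelianize g s)) '' (B : Set _)) := by
  apply le_antisymm
  · rw [Submodule.span_le]
    rintro _ ⟨s, hs, rfl⟩
    rw [SetLike.mem_coe, Subgroup.sup_eq_closure] at hs
    induction hs using Subgroup.closure_induction with
    | mem x hx =>
      rcases hx with hx | hx
      · exact Submodule.mem_sup_left (Submodule.subset_span ⟨x, hx, rfl⟩)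
      · exact Submodule.mem_sup_right (Submodule.subset_span ⟨x, hx, rfl⟩)
    | one => simp
    | mul x y _ _ hx hy =>
      simp only [map_mul, toAdd_mul]
      exact Submodule.add_mem _ hx hy
    | inv x _ hx =>
      simp only [map_inv, toAdd_inv]
      exact Submodule.neg_mem _ hx
  · refine sup_le (Submodule.span_mono (Set.image_mono ?_)) (Submodule.span_mono (Set.image_mono ?_))
    · exact fun x hx => Subgroup.mem_sup_left hx
    · exact fun x hx => Subgroup.mem_sup_right hx

/-- The image in `H₁` of the whole group spans `H₁`. [folklore] -/
theorem SurfaceGroup.span_image_top {g : ℕ} :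
    Submodule.span ℤ ((fun s => toAdd (SurfaceGroup.abelianize g s)) '' ((⊤ : Subgroup (SurfaceGroup g)) : Set _)) = ⊤ := by
  rw [eq_top_iff]
  rintro v -
  obtain ⟨s, hs⟩ := SurfaceGroup.abelianize_surjective g (ofAdd v)
  exact Submodule.subset_span ⟨s, Subgroup.mem_top s, by simp only; rw [hs, toAdd_ofAdd]⟩

/-- The image in `H₁` of a normal closure spans the same submodule as the image of the
generating set (conjugation is invisible in `H₁`). [folklore] -/
theorem SurfaceGroup.span_image_normalClosure {g : ℕ} (T : Set (SurfaceGroup g)) :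
    Submodule.span ℤ ((fun s => toAdd (SurfaceGroup.abelianize g s)) '' (normalClosure T : Set _)) =
      Submodule.span ℤ ((fun s => toAdd (SurfaceGroup.abelianize g s)) '' T) := by
  apply le_antisymm
  · rw [Submodule.span_le]
    rintro _ ⟨s, hs, rfl⟩
    rw [SetLike.mem_coe] at hs
    induction hs using Subgroup.closure_induction with
    | mem x hx =>
      obtain ⟨a, ha, hax⟩ := Group.mem_conjugatesOfSet_iff.1 hx
      obtain ⟨c, hc⟩ := isConj_iff.1 hax
      have : SurfaceGroup.abelianize g x = SurfaceGroup.abelianize g a := by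
        rw [← hc, map_mul, map_mul, map_inv, mul_comm (SurfaceGroup.abelianize g c),
          mul_inv_cancel_right]
      refine Submodule.subset_span ⟨a, ha, ?_⟩
      simp only
      rw [this]
    | one => simp
    | mul x y _ _ hx hy =>
      simp only [map_mul, toAdd_mul]
      exact Submodule.add_mem _ hx hy
    | inv x _ hx =>
      simp only [map_inv, toAdd_inv]
      exact Submodule.neg_mem _ hx
  · exact Submodule.span_mono (Set.image_mono subset_normalClosure)


/-- The abelianisation map identifies `s, t ∈ S_g` iff they differ by an element of the
commutator subgroup: `[s] = [t] ↔ s⁻¹ t ∈ [S_g, S_g]`. [folklore] -/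
theorem SurfaceGroup.abelianize_eq_iff (g : ℕ) (s t : SurfaceGroup g) :
    SurfaceGroup.abelianize g s = SurfaceGroup.abelianize g t ↔ s⁻¹ * t ∈ commutator (SurfaceGroup g) := by
  rw [← SurfaceGroup.ker_abelianize, MonoidHom.mem_ker, map_mul, map_inv, inv_mul_eq_one, eq_comm]

end Literature.Topology.FourManifolds

end
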